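import Summits.CriticalPhenomena.PercolationContinuityZ3.Theorems.Transplant.LineGraphSiteContinuity
import Summits.CriticalPhenomena.PercolationContinuityZ3.Theorems.Transplant.Z3NetSkeleton
import Summits.CriticalPhenomena.PercolationContinuityZ3.Theorems.Transplant.Z3RungDiluted
import Summits.CriticalPhenomena.PercolationContinuityZ3.Theorems.Transplant.SkeletonConcProductsHolds
import Summits.CriticalPhenomena.PercolationContinuityZ3.Theorems.Transplant.CdsNetCritical
import Summits.CriticalPhenomena.PercolationContinuityZ3.Theorems.Transplant.SqpNetCritical
import Summits.CriticalPhenomena.PercolationContinuityZ3.Theorems.Transplant.SkelConcHolds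
import Summits.CriticalPhenomena.PercolationContinuityZ3.Theorems.Transplant.SkeletonSign1CustomersHolds
import HarnessLib

/-!
# SITE percolation on covering (line) graphs — the customers of the Fisher–Essam / Kesten device across the lane's bond table, and the
# gen-13 catalogue

builds on p205010 (kernel theorem, internal audit signed; external expert review pending).
Status sentence (coordinator 2026-08-20T04:30Z): "θ(p_c) = 0 on ℤ^d, all d ≥ 2 — kernel-verified (Lean 4/Mathlib,
standard axioms); internal adversarial audit SIGNED 2026-08-20 04:29Z; external expert review pending."

Lane `prim-bschramm-*`, seat `prim-bschramm-p2` (gen 13; class C1b, METHOD = input substitution).  `LineGraphSiteContinuity.lean` proved: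
bond percolation on `G` dies at its own critical point at every vertex ⟹ SITE percolation on the covering lattice `G̃ = G.lineGraph`
(vertices = bonds of `G`, adjacent iff they share an endpoint) dies at its own critical point at every vertex
(`lineGraph_siteCriticalContinuity_of_bond`).  This file applies it to the PROVED bond rows of the lane's table (memo P2-LATTICES): each is
one line, and each is a statement about a 3D (or quasi-2D) SITE model that no skeleton interface of the lane addresses directly (the lane's
skeleton nodes are BOND devices; the tree's site theorems cover `ℤ^d` only):
* `z3NetLineGraph_siteCriticalContinuity` — the covering lattice of EVERY periodic bond structure on `ℤ³` with sign data (gen 12's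
  `Z3Net.SignData`), in particular of every rung-diluted cubic lattice (`rungDilutedLineGraph_siteCriticalContinuity`);
* `fccLineGraph_…`, `bccLineGraph_…` — the covering lattices of the fcc and bcc lattices;
* `cdsLineGraph_…`, `sqpLineGraph_…` — of the `cds` (CdSO₄) net and of the alternating-rung (square-pyramidal) net;
* `heisenbergLineGraph_…` — of the Cayley graph of the Heisenberg group `H₃(ℤ)` (generators `a^{±1}, b^{±1}`);
* `stackedTriangularLineGraph_…` — of the stacked triangular lattice `𝕋 × ℤ`;
* `c1bGen13_lineGraph_catalogue` — the conjunction, with the pyrochlore and `ℤ^d` rows of `LineGraphSiteContinuity.lean`.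
All kernel theorems via the audited nodes + p205010; none in print (Benjamini–Schramm Conj. 4 instances for SITE percolation on
(quasi-)transitive covering lattices).
[cite: Kesten1982, §2.5 and §3.1 Prop. 3.1] [cite: FisherEssam1961, §2] [cite: BenjaminiSchramm1996, Conj. 4]
-/

noncomputable section

namespace Summit.CriticalPhenomena.PercolationContinuityZ3.Theorems.Transplant

open MeasureTheory Literature.Probability.Percolation Literature.Probability.LatticeModels SimpleGraph

/-! ## §1 Periodic nets on `ℤ³` -/

/-- **Site percolation on the covering lattice of EVERY periodic bond structure on `ℤ³` with sign data dies at its own critical point**, at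
every vertex (gen 12's `Z3Net.SignData.criticalContinuity` through the covering-graph device). [cite: BenjaminiSchramm1996, Conj. 4]
[cite: Kesten1982, §3.1 Prop. 3.1] -/
theorem z3NetLineGraph_siteCriticalContinuity (N : Z3Net) (D : N.SignData) (e : N.graph.edgeSet) :
    siteTheta N.graph.lineGraph e (siteCriticalProbIOf N.graph.lineGraph e) = 0 :=
  lineGraph_siteCriticalContinuity_of_bond (D.criticalContinuity) e

/-- **… in particular of every RUNG-DILUTED cubic lattice** (pcu, alternating, staggered, striped, sparse, …).
[cite: BenjaminiSchramm1996, Conj. 4] -/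
theorem rungDilutedLineGraph_siteCriticalContinuity (P : RungPattern) (e : P.net.graph.edgeSet) :
    siteTheta P.net.graph.lineGraph e (siteCriticalProbIOf P.net.graph.lineGraph e) = 0 :=
  lineGraph_siteCriticalContinuity_of_bond P.criticalContinuity e

/-- **Site percolation on the covering lattice of the `cds` (CdSO₄) net dies at its own critical point.** [cite: BenjaminiSchramm1996, Conj. 4] -/
theorem cdsLineGraph_siteCriticalContinuity (e : Cds.graph.edgeSet) :
    siteTheta Cds.graph.lineGraph e (siteCriticalProbIOf Cds.graph.lineGraph e) = 0 :=
  lineGraph_siteCriticalContinuity_of_bond Cds.criticalContinuity e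

/-- **Site percolation on the covering lattice of the alternating-rung (square-pyramidal) net dies at its own critical point.**
[cite: BenjaminiSchramm1996, Conj. 4] -/
theorem sqpLineGraph_siteCriticalContinuity (e : Sqp.graph.edgeSet) :
    siteTheta Sqp.graph.lineGraph e (siteCriticalProbIOf Sqp.graph.lineGraph e) = 0 :=
  lineGraph_siteCriticalContinuity_of_bond Sqp.criticalContinuity e

/-! ## §2 The cubic system: fcc and bcc -/

/-- **Site percolation on the covering lattice of the fcc lattice dies at its own critical point.** [cite: BenjaminiSchramm1996, Conj. 4] -/
theorem fccLineGraph_siteCriticalContinuity (e : fccGraph.edgeSet) :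
    siteTheta fccGraph.lineGraph e (siteCriticalProbIOf fccGraph.lineGraph e) = 0 :=
  lineGraph_siteCriticalContinuity_of_bond fcc_criticalContinuity_holds e

/-- **Site percolation on the covering lattice of the bcc lattice dies at its own critical point.** [cite: BenjaminiSchramm1996, Conj. 4] -/
theorem bccLineGraph_siteCriticalContinuity (e : bccGraph.edgeSet) :
    siteTheta bccGraph.lineGraph e (siteCriticalProbIOf bccGraph.lineGraph e) = 0 :=
  lineGraph_siteCriticalContinuity_of_bond bcc_criticalContinuity_holds e

/-! ## §3 Beyond `ℤ³`-periodic: the Heisenberg group and the stacked triangular lattice -/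

/-- **Site percolation on the covering graph of the Cayley graph of the Heisenberg group `H₃(ℤ)` (generators `a^{±1}, b^{±1}`) dies at its own
critical point** — a SITE instance of Conjecture 4 on a graph of polynomial growth of degree `4`. [cite: BenjaminiSchramm1996, Conj. 4] -/
theorem heisenbergLineGraph_siteCriticalContinuity (e : Heisenberg.heisenbergGraph.edgeSet) :
    siteTheta Heisenberg.heisenbergGraph.lineGraph e (siteCriticalProbIOf Heisenberg.heisenbergGraph.lineGraph e) = 0 :=
  lineGraph_siteCriticalContinuity_of_bond heisenbergCriticalContinuityAll_holds e

/-- **Site percolation on the covering lattice of the stacked triangular lattice `𝕋 × ℤ` dies at its own critical point.**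
[cite: BenjaminiSchramm1996, Conj. 4] -/
theorem stackedTriangularLineGraph_siteCriticalContinuity (e : stackedTriangularGraph.edgeSet) :
    siteTheta stackedTriangularGraph.lineGraph e (siteCriticalProbIOf stackedTriangularGraph.lineGraph e) = 0 :=
  lineGraph_siteCriticalContinuity_of_bond stackedTriangular_criticalContinuity_holds e

/-! ## §4 The gen-13 catalogue -/

/-- **C1b gen-13 catalogue — SITE percolation on covering (line) graphs at their own critical points, all kernel theorems**: the covering
lattices of `ℤ^d` (`d ≥ 2`), of the diamond lattice (= the PYROCHLORE lattice), of every periodic net on `ℤ³` with sign data (all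
rung-diluted cubic lattices), of fcc, bcc, `cds`, the alternating-rung net, the Heisenberg Cayley graph and `𝕋 × ℤ`.  builds on p205010
(kernel theorem, internal audit signed; external expert review pending). [cite: BenjaminiSchramm1996, Conj. 4] [cite: Kesten1982, §3.1 Prop. 3.1] -/
theorem c1bGen13_lineGraph_catalogue :
    (∀ d, 2 ≤ d → ∀ e : (zdGraph d).edgeSet, siteTheta (zdGraph d).lineGraph e (siteCriticalProbIOf (zdGraph d).lineGraph e) = 0) ∧
    (∀ e : diamondGraph.edgeSet, siteTheta diamondGraph.lineGraph e (siteCriticalProbIOf diamondGraph.lineGraph e) = 0) ∧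
    (∀ (N : Z3Net) (_ : N.SignData) (e : N.graph.edgeSet), siteTheta N.graph.lineGraph e (siteCriticalProbIOf N.graph.lineGraph e) = 0) ∧
    (∀ (P : RungPattern) (e : P.net.graph.edgeSet), siteTheta P.net.graph.lineGraph e (siteCriticalProbIOf P.net.graph.lineGraph e) = 0) ∧
    (∀ e : fccGraph.edgeSet, siteTheta fccGraph.lineGraph e (siteCriticalProbIOf fccGraph.lineGraph e) = 0) ∧
    (∀ e : bccGraph.edgeSet, siteTheta bccGraph.lineGraph e (siteCriticalProbIOf bccGraph.lineGraph e) = 0) ∧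
    (∀ e : Cds.graph.edgeSet, siteTheta Cds.graph.lineGraph e (siteCriticalProbIOf Cds.graph.lineGraph e) = 0) ∧
    (∀ e : Sqp.graph.edgeSet, siteTheta Sqp.graph.lineGraph e (siteCriticalProbIOf Sqp.graph.lineGraph e) = 0) ∧
    (∀ e : Heisenberg.heisenbergGraph.edgeSet,
      siteTheta Heisenberg.heisenbergGraph.lineGraph e (siteCriticalProbIOf Heisenberg.heisenbergGraph.lineGraph e) = 0) ∧
    (∀ e : stackedTriangularGraph.edgeSet,
      siteTheta stackedTriangularGraph.lineGraph e (siteCriticalProbIOf stackedTriangularGraph.lineGraph e) = 0) :=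
  ⟨zdLineGraph_siteCriticalContinuity, diamondLineGraph_siteCriticalContinuity, z3NetLineGraph_siteCriticalContinuity,
    rungDilutedLineGraph_siteCriticalContinuity, fccLineGraph_siteCriticalContinuity, bccLineGraph_siteCriticalContinuity,
    cdsLineGraph_siteCriticalContinuity, sqpLineGraph_siteCriticalContinuity, heisenbergLineGraph_siteCriticalContinuity,
    stackedTriangularLineGraph_siteCriticalContinuity⟩

/-- The identity of critical values behind every row: `p_c^{site}(G̃, ṽ(e)) = p_c^{bond}(G, v)` for every endpoint `v` of `e` — stated for
the rung-diluted nets as a representative `∀`-family. [cite: FisherEssam1961, §2] [cite: Kesten1982, §3.1 Prop. 3.1] -/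
theorem rungDilutedLineGraph_siteCriticalProb_eq (P : RungPattern) (e : P.net.graph.edgeSet) {v : Site 3} (hv : v ∈ (e : Sym2 (Site 3))) :
    siteCriticalProbIOf P.net.graph.lineGraph e = criticalProbIOf P.net.graph v :=
  siteCriticalProbIOf_lineGraph_eq e hv

end Summit.CriticalPhenomena.PercolationContinuityZ3.Theorems.Transplant

end
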